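import Mathlib
import HarnessLib
import Literature.Analysis.FluidPDE.SwirlTransportProofs
import Summits.NavierStokesRegularity.NavierStokesRegularity.Theorems.PoloidalWindowDoorPoloidalWindowRigidityOneSliceCurlAxisymmetric
import Summits.NavierStokesRegularity.NavierStokesRegularity.Theorems.PoloidalWindowDoorPoloidalWindowRigidityLocalVorticitySymmetry

/-!
# Route `PoloidalWindowDoor`, crux `PoloidalWindowRigidity` (K2, stmt-NavierStokesRegularity-19708) — the ISOPARAMETRIC GLUE:
# a slice vorticity tangent to concentric circles (or of fixed direction) with a leaf-constant amplitude carries the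
# rotation (translation) germ, hence the apex is regular

Cell ns-regularity-ideate, K2 lead ns-poloidal-K2-p1 (gen 5; kinematic glue, `--supports stmt-…-19708` helper).  The lead's
STRUCT-NOTES-g5 §5 found that at the collapse order of the poloidal jet scheme the vortex-line foliation of every
horizontal plane is ISOPARAMETRIC (exactly, to rounding) — concentric circles about a common vertical axis, `|ω|`
constant on each circle — and the planar Levi-Civita–Segre theorem (Literature `PlaneIsoparametric*`, landed today) turns
an isoparametric foliation into exactly that shape.  This file is the last, kinematic step to the crux's currency:

* `rotGen_eq_fderiv_of_circular` — CLASS-FREE: if on an open `U ⊆ ℝ³` a `C¹` field has the form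
  `F(y) = μ(y) · J(y − c)` (tangent to the horizontal circles about the vertical axis through `c`) with an amplitude `μ`
  whose derivative along `J(y − c)` vanishes (constant on those circles), then `J F(y) = DF(y)[J(y − c)]` on `U` — the
  rotation germ of the stub `stub_lrcGeneric`.
* `fderiv_eq_zero_of_unidirectional` — CLASS-FREE twin: `F(y) = μ(y) · e` with `∂_e μ = 0` on `U` ⇒ `DF(y)[e] = 0`
  (translation germ).
* `nonflatLiouville_of_circular_curl` / `nonflatLiouville_of_unidirectional_curl` — for a profile of the route's Type-I
  class, poloidal along `e₃`: such a shape of `curl v(s)` on a nonempty open set of ONE slice ⇒ the apex is regular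
  (tree: `…KillingOpenSet` / `…OneSliceCurlAxisymmetric.nonflatLiouville_of_curl_rotDefect_eq_zero_on_open`,
  `…LocalVorticitySymmetry.nonflatLiouville_of_local_curl_translation`).

WHAT THIS IS NOT: not the research middle (ISO)+(AXIS) «thick-stratum poloidal germs have isoparametric vortex-line
foliations with a height-independent centre» — only the glue from that shape to the crux (bears_on LADDER-NS N0).
-/

noncomputable section

set_option linter.dupNamespace false

namespace Summit.NavierStokesRegularity.NavierStokesRegularity.Theorems.PoloidalWindowDoorPoloidalWindowRigidityIsoparametricGlue

open Set Function Filter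
open scoped RealInnerProductSpace InnerProductSpace
open _root_.Topology
open Literature.Analysis Literature.Analysis.FluidPDE
open Summit.NavierStokesRegularity.NavierStokesRegularity.Theorems.PoloidalWindowDoorPoloidalWindowRigidityOneSliceCurlAxisymmetric
open Summit.NavierStokesRegularity.NavierStokesRegularity.Theorems.PoloidalWindowDoorPoloidalWindowRigidityLocalVorticitySymmetry

variable {C : ℝ} {v : ℝ → EuclideanSpace ℝ (Fin 3) → EuclideanSpace ℝ (Fin 3)}

/-! ### Class-free kinematics -/

/-- **Rotation germ from a circular shape.**  If `F(y) = μ(y) · J(y − c)` near `x` with `μ` differentiable at `x` and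
`Dμ(x)[J(x − c)] = 0`, then `J F(x) = DF(x)[J(x − c)]`. -/
theorem rotGen_eq_fderiv_of_circular {F : EuclideanSpace ℝ (Fin 3) → EuclideanSpace ℝ (Fin 3)}
    {μ : EuclideanSpace ℝ (Fin 3) → ℝ} {c x : EuclideanSpace ℝ (Fin 3)}
    (hF : ∀ᶠ y in 𝓝 x, F y = μ y • rotGen (y - c)) (hμ : DifferentiableAt ℝ μ x)
    (hμ0 : fderiv ℝ μ x (rotGen (x - c)) = 0) :
    rotGen (F x) = fderiv ℝ F x (rotGen (x - c)) := by
  -- derivative of `y ↦ μ y • J(y − c)`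
  have hK : HasFDerivAt (fun y : EuclideanSpace ℝ (Fin 3) => rotGen (y - c)) rotGenL x := by
    have h1 : HasFDerivAt (fun y : EuclideanSpace ℝ (Fin 3) => y - c) (ContinuousLinearMap.id ℝ _) x :=
      (hasFDerivAt_id x).sub_const c
    have h2 := rotGenL.hasFDerivAt.comp x h1
    simpa [Function.comp_def] using h2
  have hG : HasFDerivAt (fun y => μ y • rotGen (y - c))
      (μ x • (rotGenL : EuclideanSpace ℝ (Fin 3) →L[ℝ] EuclideanSpace ℝ (Fin 3)) +
        (fderiv ℝ μ x).smulRight (rotGen (x - c))) x :=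
    hμ.hasFDerivAt.smul hK
  have heq : F =ᶠ[𝓝 x] fun y => μ y • rotGen (y - c) := hF
  rw [heq.fderiv_eq, hG.fderiv, hF.self_of_nhds]
  simp only [_root_.add_apply, FunLike.coe_smul, Pi.smul_apply, rotGenL_apply,
    ContinuousLinearMap.smulRight_apply, hμ0, zero_smul, add_zero]
  -- J (μ • J w) = μ • J (J w)
  ext i
  fin_cases i <;> (simp [rotGen]; try ring)

/-- **Translation germ from a unidirectional shape.**  If `F(y) = μ(y) · e` near `x` with `μ` differentiable at `x`
and `Dμ(x)[e] = 0`, then `DF(x)[e] = 0`. -/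
theorem fderiv_eq_zero_of_unidirectional {F : EuclideanSpace ℝ (Fin 3) → EuclideanSpace ℝ (Fin 3)}
    {μ : EuclideanSpace ℝ (Fin 3) → ℝ} {e x : EuclideanSpace ℝ (Fin 3)}
    (hF : ∀ᶠ y in 𝓝 x, F y = μ y • e) (hμ : DifferentiableAt ℝ μ x) (hμ0 : fderiv ℝ μ x e = 0) :
    fderiv ℝ F x e = 0 := by
  have hG : HasFDerivAt (fun y => μ y • e) ((fderiv ℝ μ x).smulRight e) x := hμ.hasFDerivAt.smul_const e
  have heq : F =ᶠ[𝓝 x] fun y => μ y • e := hF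
  rw [heq.fderiv_eq, hG.fderiv]
  simp [ContinuousLinearMap.smulRight_apply, hμ0]

/-! ### The glue for the class -/

/-- **Circular vortex-line foliation on an open set of one slice ⇒ regular apex.**  For a profile of the route's
Type-I class, poloidal along `e₃`: if on a nonempty open `U` of one slice `s < 0` the vorticity has the form
`curl v(s)(y) = μ(y) · J(y − c)` with `μ` differentiable and constant along the circles (`Dμ(y)[J(y − c)] = 0`), then
`v` is not backward-singular at the apex. -/
theorem nonflatLiouville_of_circular_curl (hrate : HasTypeITimeDecay C v)
    (hcont : ContinuousOn (uncurry v) (Iio (0 : ℝ) ×ˢ univ))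
    (hmild : ∀ s t : ℝ, s < t → t < 0 → ∀ x,
      v t x = UnboundedOperators.heatExtension (v s) (t - s) x - oseenDuhamel 1 s v v t x)
    (hdiv : ∀ t < 0, VectorCalculus.IsDivFree (v t))
    (hpol : ∀ s < 0, ∀ y, ⟪curl (v s) y, EuclideanSpace.single 2 1⟫_ℝ = 0)
    {s : ℝ} (hs : s < 0) {U : Set (EuclideanSpace ℝ (Fin 3))} (hU : IsOpen U) (hne : U.Nonempty)
    {μ : EuclideanSpace ℝ (Fin 3) → ℝ} (c : EuclideanSpace ℝ (Fin 3))
    (hshape : ∀ y ∈ U, curl (v s) y = μ y • rotGen (y - c))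
    (hμ : ∀ y ∈ U, DifferentiableAt ℝ μ y) (hμ0 : ∀ y ∈ U, fderiv ℝ μ y (rotGen (y - c)) = 0) :
    ¬ IsBackwardSingularPoint v 0 := by
  refine nonflatLiouville_of_curl_rotDefect_eq_zero_on_open hrate hcont hmild hdiv hpol c hs hU hne fun y hy => ?_
  have hF : ∀ᶠ z in 𝓝 y, curl (v s) z = μ z • rotGen (z - c) := by
    filter_upwards [hU.mem_nhds hy] with z hz using hshape z hz
  exact rotGen_eq_fderiv_of_circular hF (hμ y hy) (hμ0 y hy)

/-- **Unidirectional vorticity with leaf-constant amplitude on an open set of one slice ⇒ regular apex.** -/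
theorem nonflatLiouville_of_unidirectional_curl (hrate : HasTypeITimeDecay C v)
    (hcont : ContinuousOn (uncurry v) (Iio (0 : ℝ) ×ˢ univ))
    (hmild : ∀ s t : ℝ, s < t → t < 0 → ∀ x,
      v t x = UnboundedOperators.heatExtension (v s) (t - s) x - oseenDuhamel 1 s v v t x)
    (hdiv : ∀ t < 0, VectorCalculus.IsDivFree (v t))
    {s : ℝ} (hs : s < 0) {U : Set (EuclideanSpace ℝ (Fin 3))} (hU : IsOpen U) (hne : U.Nonempty)
    {μ : EuclideanSpace ℝ (Fin 3) → ℝ} {e : EuclideanSpace ℝ (Fin 3)} (he : e ≠ 0)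
    (hshape : ∀ y ∈ U, curl (v s) y = μ y • e)
    (hμ : ∀ y ∈ U, DifferentiableAt ℝ μ y) (hμ0 : ∀ y ∈ U, fderiv ℝ μ y e = 0) :
    ¬ IsBackwardSingularPoint v 0 := by
  refine nonflatLiouville_of_local_curl_translation hrate hcont hmild hdiv hs he hU hne fun y hy => ?_
  have hF : ∀ᶠ z in 𝓝 y, curl (v s) z = μ z • e := by
    filter_upwards [hU.mem_nhds hy] with z hz using hshape z hz
  exact fderiv_eq_zero_of_unidirectional hF (hμ y hy) (hμ0 y hy)

end Summit.NavierStokesRegularity.NavierStokesRegularity.Theorems.PoloidalWindowDoorPoloidalWindowRigidityIsoparametricGlue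

end
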